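import Summits.HubbardSuperconductivity.HubbardSuperconductivity.Theorems.AnisotropyChordDoobJohnsonChordPerronFamily
import Summits.HubbardSuperconductivity.HubbardSuperconductivity.Theorems.AnisotropyChordChordXYRatioAntitone

/-!
# Route `AnisotropyChord`, crux `ChordXY` (stmt-HubbardSuperconductivity-8146), line `doob-johnson-chord`:
# `ChordXY` from the BARE log-slope inequality along the smooth Perron family (lead-8146-chordxy g1)

`chordXY_of_logSlope_smooth`: if for every even `M ≥ 4` and every `C^∞` family `Ψ` of real non-negative
normalised `S^z_tot = 0` sector ground states of `H_M(·)` the LOG-SLOPE BOUND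
`(1+u) · d/du Λ(Ψ u) ≤ Λ(Ψ u)` holds on `(-1,0)`, then the route item `ChordXY` holds.  The regularity
hypotheses of `chordXY_of_logSlope` (`…ChordXYRatioAntitone`) are discharged by
`exists_smooth_perronFamily` / `contDiff_lam_family` (`…DoobJohnsonChordPerronFamily`): such a family
EXISTS and along it `Λ` is `C^∞`.  What remains — the hypothesis, explicit, no `def` — is the
stub-critic's H2 (the diagonal of PLAN A), the open content of the line.  [bookkeeping]
HONEST: the log-slope inequality is NOT proved here; nothing in this file proves `stub_frozenFieldChord`
or `ChordXY`; superconductivity in the Hubbard model is not advanced.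
-/

set_option linter.dupNamespace false

noncomputable section

namespace Summit.HubbardSuperconductivity.HubbardSuperconductivity.Theorems.AnisotropyChord.DoobJohnsonChord

open Matrix Finset
open scoped ContDiff
open Literature.MathematicalPhysics.QuantumLattice Literature.Probability.LatticeModels

/-! ### The crux from the bare log-slope inequality -/

/-- **`ChordXY` from the log-slope inequality alone.**  If for every even `M ≥ 4` and every `C^∞`
family `Ψ` of real non-negative normalised `S^z_tot = 0` sector ground states of `H_M(·)` the LOG-SLOPE
BOUND `(1+u) · d/du Λ(Ψ u) ≤ Λ(Ψ u)` holds on `(-1,0)`, then the route item `ChordXY` holds — the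
differentiability and continuity hypotheses of `chordXY_of_logSlope` are discharged by
`exists_smooth_perronFamily` / `contDiff_lam_family` (such a family EXISTS, and along it `Λ` is `C^∞`).
The hypothesis is the stub-critic's H2 (diagonal of PLAN A), the open content; explicit, no `def`.
[bookkeeping] -/
theorem chordXY_of_logSlope_smooth
    (hLS : ∀ (M : ℕ) [NeZero M], Even M → 4 ≤ M → ∀ Ψ : ℝ → Config M → ℝ, ContDiff ℝ ∞ Ψ →
      (∀ u, IsGS M u (ofReal M (Ψ u))) → (∀ u σ, 0 ≤ Ψ u σ) →
      ∀ u ∈ Set.Ioo (-1:ℝ) 0,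
        (1 + u) * deriv (fun v => lam M (ofReal M (Ψ v))) u ≤ lam M (ofReal M (Ψ u))) :
    Summit.HubbardSuperconductivity.HubbardSuperconductivity.Theses.AnisotropyChord.ChordXY := by
  refine chordXY_of_logSlope fun M _ hE h4 => ?_
  obtain ⟨Ψ, hΨs, hGS, hnn, -, -, -⟩ := exists_smooth_perronFamily M hE
  have hd : Differentiable ℝ (fun v => lam M (ofReal M (Ψ v))) :=
    (contDiff_lam_family M hΨs).differentiable (by simp)
  exact ⟨Ψ, deriv (fun v => lam M (ofReal M (Ψ v))), hGS, fun u _ => (hd u).hasDerivAt,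
    fun u hu => hLS M hE h4 Ψ hΨs hGS hnn u hu, (hd.continuous.continuousAt).continuousWithinAt⟩

end Summit.HubbardSuperconductivity.HubbardSuperconductivity.Theorems.AnisotropyChord.DoobJohnsonChord

end
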